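import Literature.Computability.MetaComplexity.LevelledRefutationCNF
import HarnessLib

/-!
# The axioms of Garlík's `REF^F_{s,t}`: shapes of the fifteen clause families

Support file for the proof of `levelledRefCNF_lowerBound` ([Garlík 2019, Thm 1], file
`LevelledRefutationCNF.lean`). The adversary argument of [Garlík 2019, §4] (Lemmas 16, 17, 19)
never inspects the list structure of `REF^F_{s,t}`; it only needs to know, for each clause of the
formula, which of the fifteen printed shapes it has, with its indices in range. This file provides
exactly that interface:

* `LevelledRefCNF.fclause X F m` — the clause `C_m` of `F` re-indexed over the variable list `X`
  (the literal `(x, b)` of `F[m]` becomes `(X.idxOf x, b)`), as a `Finset (ℕ × Bool)`;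
* `LevelledRefCNF.IsAxiom n r s t Fc c` — `c : Clause LRefVar` has one of the fifteen shapes of
  [Garlík 2019, §3] with indices in range (`Fc m` playing the role of `C_m`);
* `LevelledRefCNF.isAxiom_of_mem_lref` — every clause of `lref X F s t` is such an axiom
  (with `n = |X|`, `r = |F|`, `Fc = fclause X F`);
* `mem_clauseFinsets_levelledRefCNF` — the set-clauses of `levelledRefCNF F s t` are the images
  under `LRefVar.code` of the clauses of `lref (sortedVars F) F s t`;
* the transfer of the hypotheses on `F` to `fclause`: range (`fclause_subset`), non-tautology
  (`fclause_nonTaut`) and unsatisfiability in the form used by the adversary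
  (`exists_fclause_subset_of_not_satisfiable`: every full clause over `x_0, …, x_{n-1}` is a
  weakening of some `C_m`, [Garlík 2019, proof of Lemma 17, case 1]).

## References

* M. Garlík, *Resolution lower bounds for refutation statements*, MFCS 2019 / arXiv:1905.12372,
  §3 (the clause list), §4.
-/

namespace Literature.Computability.MetaComplexity

open _root_.Computability Complexity

namespace LevelledRefCNF

/-! ### The clauses of `F` over variable indices -/

/-- The clause `C_m = F[m]` of `F` written over variable *indices*: the literal `(x, b)` becomes
`(X.idxOf x, b)` where `X` is the list of variables (`[]` out of range).
[cite: Garlik2019, §3 (the clauses `C_1, …, C_r` of `F` in the variables `x_1, …, x_n`)] -/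
def fclause (X : List ℕ) (F : CNF ℕ) (m : ℕ) : Finset (ℕ × Bool) :=
  ((F.getD m []).map fun l => (X.idxOf l.1, l.2)).toFinset

/-- Membership in `fclause`. [folklore] -/
theorem mem_fclause {X : List ℕ} {F : CNF ℕ} {m : ℕ} {q : ℕ × Bool} :
    q ∈ fclause X F m ↔ ∃ l ∈ F.getD m [], (X.idxOf l.1, l.2) = q := by
  simp [fclause]

/-- The literal `(x, b)` of `F[m]` yields `(X.idxOf x, b) ∈ fclause X F m`. [folklore] -/
theorem mem_fclause_of_mem {X : List ℕ} {F : CNF ℕ} {m : ℕ} {l : Literal ℕ}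
    (hl : l ∈ F.getD m []) : (X.idxOf l.1, l.2) ∈ fclause X F m :=
  mem_fclause.2 ⟨l, hl, rfl⟩

/-! ### The fifteen shapes -/

/-- `IsAxiom n r s t Fc c`: the clause `c` over `LRefVar` has one of the fifteen shapes of the
clauses of `REF^F_{s,t}` printed in [Garlík 2019, §3], with all indices in range (0-based, the
upper level of a two-level family written `p + 1` with `p + 1 < s`), the clause `C_m` of `F`
being `Fc m`. [cite: Garlik2019, §3 (the fifteen families of clauses of REF^F_{s,t})] -/
inductive IsAxiom (n r s t : ℕ) (Fc : ℕ → Finset (ℕ × Bool)) : Clause LRefVar → Prop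
  /-- (B1) `¬I(j,m) ∨ D(1,j,ℓ,b)` for `x_ℓ^b ∈ C_m` -/
  | b1 {j m ℓ : ℕ} {b : Bool} : j < t → m < r → (ℓ, b) ∈ Fc m →
      IsAxiom n r s t Fc [(LRefVar.I j m, false), (LRefVar.D 0 j ℓ b, true)]
  /-- (B2) `¬D(i,j,ℓ,1) ∨ ¬D(i,j,ℓ,0)` -/
  | b2 {i j ℓ : ℕ} : i < s → j < t → ℓ < n →
      IsAxiom n r s t Fc [(LRefVar.D i j ℓ true, false), (LRefVar.D i j ℓ false, false)]
  /-- (B3) `¬L(i,j,j') ∨ ¬V(i,j,ℓ) ∨ D(i-1,j',ℓ,1)` -/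
  | b3 {p j j' ℓ : ℕ} : p + 1 < s → j < t → j' < t → ℓ < n →
      IsAxiom n r s t Fc [(LRefVar.L (p + 1) j j', false), (LRefVar.V (p + 1) j ℓ, false),
        (LRefVar.D p j' ℓ true, true)]
  /-- (B4) `¬R(i,j,j') ∨ ¬V(i,j,ℓ) ∨ D(i-1,j',ℓ,0)` -/
  | b4 {p j j' ℓ : ℕ} : p + 1 < s → j < t → j' < t → ℓ < n →
      IsAxiom n r s t Fc [(LRefVar.R (p + 1) j j', false), (LRefVar.V (p + 1) j ℓ, false),
        (LRefVar.D p j' ℓ false, true)]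
  /-- (B5) `¬L(i,j,j') ∨ ¬V(i,j,ℓ) ∨ ¬D(i-1,j',ℓ',b) ∨ D(i,j,ℓ',b)`, `(ℓ',b) ≠ (ℓ,1)` -/
  | b5 {p j j' ℓ ℓ' : ℕ} {b : Bool} : p + 1 < s → j < t → j' < t → ℓ < n → ℓ' < n →
      ¬ (ℓ' = ℓ ∧ b = true) →
      IsAxiom n r s t Fc [(LRefVar.L (p + 1) j j', false), (LRefVar.V (p + 1) j ℓ, false),
        (LRefVar.D p j' ℓ' b, false), (LRefVar.D (p + 1) j ℓ' b, true)]
  /-- (B6) `¬R(i,j,j') ∨ ¬V(i,j,ℓ) ∨ ¬D(i-1,j',ℓ',b) ∨ D(i,j,ℓ',b)`, `(ℓ',b) ≠ (ℓ,0)` -/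
  | b6 {p j j' ℓ ℓ' : ℕ} {b : Bool} : p + 1 < s → j < t → j' < t → ℓ < n → ℓ' < n →
      ¬ (ℓ' = ℓ ∧ b = false) →
      IsAxiom n r s t Fc [(LRefVar.R (p + 1) j j', false), (LRefVar.V (p + 1) j ℓ, false),
        (LRefVar.D p j' ℓ' b, false), (LRefVar.D (p + 1) j ℓ' b, true)]
  /-- (B7) `¬D(s,t,ℓ,b)` -/
  | b7 {i j ℓ : ℕ} {b : Bool} : i + 1 = s → j + 1 = t → ℓ < n →
      IsAxiom n r s t Fc [(LRefVar.D i j ℓ b, false)]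
  /-- (B8) `V(i,j,1) ∨ ⋯ ∨ V(i,j,n)` -/
  | b8 {p j : ℕ} : p + 1 < s → j < t →
      IsAxiom n r s t Fc ((List.range n).map fun ℓ => (LRefVar.V (p + 1) j ℓ, true))
  /-- (B9) `I(j,1) ∨ ⋯ ∨ I(j,r)` -/
  | b9 {j : ℕ} : j < t → IsAxiom n r s t Fc ((List.range r).map fun m => (LRefVar.I j m, true))
  /-- (B10) `L(i,j,1) ∨ ⋯ ∨ L(i,j,t)` -/
  | b10 {p j : ℕ} : p + 1 < s → j < t →
      IsAxiom n r s t Fc ((List.range t).map fun j' => (LRefVar.L (p + 1) j j', true))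
  /-- (B11) `R(i,j,1) ∨ ⋯ ∨ R(i,j,t)` -/
  | b11 {p j : ℕ} : p + 1 < s → j < t →
      IsAxiom n r s t Fc ((List.range t).map fun j' => (LRefVar.R (p + 1) j j', true))
  /-- (B12) `¬V(i,j,ℓ) ∨ ¬V(i,j,ℓ')`, `ℓ ≠ ℓ'` -/
  | b12 {p j ℓ ℓ' : ℕ} : p + 1 < s → j < t → ℓ < n → ℓ' < n → ℓ' ≠ ℓ →
      IsAxiom n r s t Fc [(LRefVar.V (p + 1) j ℓ, false), (LRefVar.V (p + 1) j ℓ', false)]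
  /-- (B13) `¬I(j,m) ∨ ¬I(j,m')`, `m ≠ m'` -/
  | b13 {j m m' : ℕ} : j < t → m < r → m' < r → m' ≠ m →
      IsAxiom n r s t Fc [(LRefVar.I j m, false), (LRefVar.I j m', false)]
  /-- (B14) `¬L(i,j,j') ∨ ¬L(i,j,j'')`, `j' ≠ j''` -/
  | b14 {p j j' j'' : ℕ} : p + 1 < s → j < t → j' < t → j'' < t → j'' ≠ j' →
      IsAxiom n r s t Fc [(LRefVar.L (p + 1) j j', false), (LRefVar.L (p + 1) j j'', false)]
  /-- (B15) `¬R(i,j,j') ∨ ¬R(i,j,j'')`, `j' ≠ j''` -/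
  | b15 {p j j' j'' : ℕ} : p + 1 < s → j < t → j' < t → j'' < t → j'' ≠ j' →
      IsAxiom n r s t Fc [(LRefVar.R (p + 1) j j', false), (LRefVar.R (p + 1) j j'', false)]

/-- The lower levels are the `p` with `p + 1 < s`. [folklore] -/
theorem mem_lowerLevels {s p : ℕ} : p ∈ lowerLevels s ↔ p + 1 < s := by
  simp only [lowerLevels, List.mem_filter, List.mem_range, decide_eq_true_eq]
  omega

variable {X : List ℕ} {F : CNF ℕ} {s t : ℕ} {c : Clause LRefVar}

/-- Shape of the clauses of (B1). [cite: Garlik2019, §3 (1st family)] -/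
theorem isAxiom_of_mem_B1 (h : c ∈ B1 X F t) :
    IsAxiom X.length F.length s t (fclause X F) c := by
  simp only [B1, List.mem_flatMap, List.mem_range, List.mem_map] at h
  obtain ⟨j, hj, m, hm, l, hl, rfl⟩ := h
  exact IsAxiom.b1 hj hm (mem_fclause_of_mem hl)

/-- Shape of the clauses of (B2). [cite: Garlik2019, §3 (2nd family)] -/
theorem isAxiom_of_mem_B2 {n : ℕ} (h : c ∈ B2 s t n) :
    IsAxiom n F.length s t (fclause X F) c := by
  simp only [B2, List.mem_flatMap, List.mem_range, List.mem_map] at h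
  obtain ⟨i, hi, j, hj, ℓ, hℓ, rfl⟩ := h
  exact IsAxiom.b2 hi hj hℓ

/-- Shape of the clauses of (B3). [cite: Garlik2019, §3 (3rd family)] -/
theorem isAxiom_of_mem_B3 {n : ℕ} (h : c ∈ B3 s t n) :
    IsAxiom n F.length s t (fclause X F) c := by
  simp only [B3, List.mem_flatMap, mem_lowerLevels, List.mem_range, List.mem_map] at h
  obtain ⟨p, hp, j, hj, j', hj', ℓ, hℓ, rfl⟩ := h
  exact IsAxiom.b3 hp hj hj' hℓ

/-- Shape of the clauses of (B4). [cite: Garlik2019, §3 (4th family)] -/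
theorem isAxiom_of_mem_B4 {n : ℕ} (h : c ∈ B4 s t n) :
    IsAxiom n F.length s t (fclause X F) c := by
  simp only [B4, List.mem_flatMap, mem_lowerLevels, List.mem_range, List.mem_map] at h
  obtain ⟨p, hp, j, hj, j', hj', ℓ, hℓ, rfl⟩ := h
  exact IsAxiom.b4 hp hj hj' hℓ

/-- Shape of the clauses of (B5). [cite: Garlik2019, §3 (5th family)] -/
theorem isAxiom_of_mem_B5 {n : ℕ} (h : c ∈ B5 s t n) :
    IsAxiom n F.length s t (fclause X F) c := by
  simp only [B5, List.mem_flatMap, mem_lowerLevels, List.mem_range, List.mem_map,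
    List.mem_filter] at h
  obtain ⟨p, hp, j, hj, j', hj', ℓ, hℓ, ℓ', hℓ', b, ⟨-, hb⟩, rfl⟩ := h
  refine IsAxiom.b5 hp hj hj' hℓ hℓ' ?_
  rintro ⟨rfl, rfl⟩
  simp at hb

/-- Shape of the clauses of (B6). [cite: Garlik2019, §3 (6th family)] -/
theorem isAxiom_of_mem_B6 {n : ℕ} (h : c ∈ B6 s t n) :
    IsAxiom n F.length s t (fclause X F) c := by
  simp only [B6, List.mem_flatMap, mem_lowerLevels, List.mem_range, List.mem_map,
    List.mem_filter] at h
  obtain ⟨p, hp, j, hj, j', hj', ℓ, hℓ, ℓ', hℓ', b, ⟨-, hb⟩, rfl⟩ := h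
  refine IsAxiom.b6 hp hj hj' hℓ hℓ' ?_
  rintro ⟨rfl, rfl⟩
  simp at hb

/-- Shape of the clauses of (B7). [cite: Garlik2019, §3 (7th family)] -/
theorem isAxiom_of_mem_B7 {n : ℕ} (h : c ∈ B7 s t n) :
    IsAxiom n F.length s t (fclause X F) c := by
  simp only [B7, List.mem_flatMap, List.mem_filter, List.mem_range, List.mem_map,
    decide_eq_true_eq] at h
  obtain ⟨i, ⟨-, hi⟩, j, ⟨-, hj⟩, ℓ, hℓ, b, -, rfl⟩ := h
  exact IsAxiom.b7 hi hj hℓ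

/-- Shape of the clauses of (B8). [cite: Garlik2019, §3 (8th family)] -/
theorem isAxiom_of_mem_B8 {n : ℕ} (h : c ∈ B8 s t n) :
    IsAxiom n F.length s t (fclause X F) c := by
  simp only [B8, List.mem_flatMap, mem_lowerLevels, List.mem_map, List.mem_range] at h
  obtain ⟨p, hp, j, hj, rfl⟩ := h
  exact IsAxiom.b8 hp hj

/-- Shape of the clauses of (B9). [cite: Garlik2019, §3 (9th family)] -/
theorem isAxiom_of_mem_B9 {n r : ℕ} (h : c ∈ B9 t r) :
    IsAxiom n r s t (fclause X F) c := by
  simp only [B9, List.mem_map, List.mem_range] at h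
  obtain ⟨j, hj, rfl⟩ := h
  exact IsAxiom.b9 hj

/-- Shape of the clauses of (B10). [cite: Garlik2019, §3 (10th family)] -/
theorem isAxiom_of_mem_B10 {n : ℕ} (h : c ∈ B10 s t) :
    IsAxiom n F.length s t (fclause X F) c := by
  simp only [B10, List.mem_flatMap, mem_lowerLevels, List.mem_map, List.mem_range] at h
  obtain ⟨p, hp, j, hj, rfl⟩ := h
  exact IsAxiom.b10 hp hj

/-- Shape of the clauses of (B11). [cite: Garlik2019, §3 (11th family)] -/
theorem isAxiom_of_mem_B11 {n : ℕ} (h : c ∈ B11 s t) :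
    IsAxiom n F.length s t (fclause X F) c := by
  simp only [B11, List.mem_flatMap, mem_lowerLevels, List.mem_map, List.mem_range] at h
  obtain ⟨p, hp, j, hj, rfl⟩ := h
  exact IsAxiom.b11 hp hj

/-- Shape of the clauses of (B12). [cite: Garlik2019, §3 (12th family)] -/
theorem isAxiom_of_mem_B12 {n : ℕ} (h : c ∈ B12 s t n) :
    IsAxiom n F.length s t (fclause X F) c := by
  simp only [B12, List.mem_flatMap, mem_lowerLevels, List.mem_range, List.mem_map,
    List.mem_filter, decide_eq_true_eq] at h
  obtain ⟨p, hp, j, hj, ℓ, hℓ, ℓ', ⟨hℓ', hne⟩, rfl⟩ := h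
  exact IsAxiom.b12 hp hj hℓ hℓ' hne

/-- Shape of the clauses of (B13). [cite: Garlik2019, §3 (13th family)] -/
theorem isAxiom_of_mem_B13 {n r : ℕ} (h : c ∈ B13 t r) :
    IsAxiom n r s t (fclause X F) c := by
  simp only [B13, List.mem_flatMap, List.mem_range, List.mem_map, List.mem_filter,
    decide_eq_true_eq] at h
  obtain ⟨j, hj, m, hm, m', ⟨hm', hne⟩, rfl⟩ := h
  exact IsAxiom.b13 hj hm hm' hne

/-- Shape of the clauses of (B14). [cite: Garlik2019, §3 (14th family)] -/
theorem isAxiom_of_mem_B14 {n : ℕ} (h : c ∈ B14 s t) :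
    IsAxiom n F.length s t (fclause X F) c := by
  simp only [B14, List.mem_flatMap, mem_lowerLevels, List.mem_range, List.mem_map,
    List.mem_filter, decide_eq_true_eq] at h
  obtain ⟨p, hp, j, hj, j', hj', j'', ⟨hj'', hne⟩, rfl⟩ := h
  exact IsAxiom.b14 hp hj hj' hj'' hne

/-- Shape of the clauses of (B15). [cite: Garlik2019, §3 (15th family)] -/
theorem isAxiom_of_mem_B15 {n : ℕ} (h : c ∈ B15 s t) :
    IsAxiom n F.length s t (fclause X F) c := by
  simp only [B15, List.mem_flatMap, mem_lowerLevels, List.mem_range, List.mem_map,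
    List.mem_filter, decide_eq_true_eq] at h
  obtain ⟨p, hp, j, hj, j', hj', j'', ⟨hj'', hne⟩, rfl⟩ := h
  exact IsAxiom.b15 hp hj hj' hj'' hne

/-- **Every clause of `REF^F_{s,t}` is one of the fifteen axioms** (with `n = |X|`, `r = |F|`
and `C_m = fclause X F m`). [cite: Garlik2019, §3 (definition of REF^F_{s,t})] -/
theorem isAxiom_of_mem_lref (h : c ∈ lref X F s t) :
    IsAxiom X.length F.length s t (fclause X F) c := by
  simp only [lref, List.mem_append] at h
  rcases h with ((((((((((((((h | h) | h) | h) | h) | h) | h) | h) | h) | h) | h) | h) | h) |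
    h) | h)
  exacts [isAxiom_of_mem_B1 h, isAxiom_of_mem_B2 h, isAxiom_of_mem_B3 h, isAxiom_of_mem_B4 h,
    isAxiom_of_mem_B5 h, isAxiom_of_mem_B6 h, isAxiom_of_mem_B7 h, isAxiom_of_mem_B8 h,
    isAxiom_of_mem_B9 h, isAxiom_of_mem_B10 h, isAxiom_of_mem_B11 h, isAxiom_of_mem_B12 h,
    isAxiom_of_mem_B13 h, isAxiom_of_mem_B14 h, isAxiom_of_mem_B15 h]

/-! ### The variable list of `F` and the set-clauses of `levelledRefCNF` -/

/-- The variables of `F` in increasing order (the list `X` used by `levelledRefCNF`).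
[cite: Garlik2019, §3 (the variables `x_1, …, x_n` of `F`)] -/
def sortedVars (F : CNF ℕ) : List ℕ :=
  (CNF.vars F).sort (· ≤ ·)

/-- `|sortedVars F| = |vars F|`. [folklore] -/
@[simp] theorem length_sortedVars (F : CNF ℕ) : (sortedVars F).length = (CNF.vars F).card :=
  Finset.length_sort _

/-- Membership in `sortedVars`. [folklore] -/
@[simp] theorem mem_sortedVars {F : CNF ℕ} {x : ℕ} : x ∈ sortedVars F ↔ x ∈ CNF.vars F :=
  Finset.mem_sort _

/-- The variable of a literal of a clause of `F` is a variable of `F`. [folklore] -/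
theorem fst_mem_vars_of_mem {F : CNF ℕ} {m : ℕ} {l : Literal ℕ} (hl : l ∈ F.getD m []) :
    l.1 ∈ CNF.vars F := by
  have hm : m < F.length := by
    by_contra hm
    rw [List.getD_eq_default _ _ (not_lt.1 hm)] at hl
    simp at hl
  rw [List.getD_eq_getElem _ _ hm] at hl
  simp only [CNF.vars, List.mem_toFinset, List.mem_map, List.mem_flatten]
  exact ⟨l, ⟨F[m], List.getElem_mem hm, hl⟩, rfl⟩

/-- The index of the variable of a literal of `F` is `< n = |vars F|`. [folklore] -/
theorem idxOf_lt_of_mem {F : CNF ℕ} {m : ℕ} {l : Literal ℕ} (hl : l ∈ F.getD m []) :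
    (sortedVars F).idxOf l.1 < (CNF.vars F).card := by
  rw [← length_sortedVars]
  exact List.idxOf_lt_length_of_mem (mem_sortedVars.2 (fst_mem_vars_of_mem hl))

/-- The set-clauses of `levelledRefCNF F s t` are the `code`-images of the clauses of
`lref (sortedVars F) F s t`. [cite: Garlik2019, §3 (REF^F_{s,t})] -/
theorem mem_clauseFinsets_levelledRefCNF {F : CNF ℕ} {s t : ℕ} {C : Finset (Literal ℕ)} :
    C ∈ (levelledRefCNF F s t).clauseFinsets ↔
      ∃ c ∈ lref (sortedVars F) F s t, (c.map fun l => (l.1.code, l.2)).toFinset = C := by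
  simp [levelledRefCNF, sortedVars, toNat, CNF.clauseFinsets]

/-! ### Transfer of the hypotheses on `F` -/

/-- The re-indexed clauses live over the variable indices `< n`. [folklore] -/
theorem fclause_subset (F : CNF ℕ) (m : ℕ) :
    fclause (sortedVars F) F m ⊆ Finset.range (CNF.vars F).card ×ˢ Finset.univ := by
  intro q hq
  obtain ⟨l, hl, rfl⟩ := mem_fclause.1 hq
  simp only [Finset.mem_product, Finset.mem_range, Finset.mem_univ, and_true]
  exact idxOf_lt_of_mem hl

/-- Non-tautological clauses of `F` stay non-tautological after re-indexing (the indexing of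
the variables of `F` is injective). [folklore] -/
theorem fclause_nonTaut {F : CNF ℕ} (hF : ∀ C ∈ F.clauseFinsets, IsNonTaut C) (m ℓ : ℕ) :
    ¬ ((ℓ, true) ∈ fclause (sortedVars F) F m ∧ (ℓ, false) ∈ fclause (sortedVars F) F m) := by
  rintro ⟨h1, h2⟩
  obtain ⟨l₁, hl₁, he₁⟩ := mem_fclause.1 h1
  obtain ⟨l₂, hl₂, he₂⟩ := mem_fclause.1 h2
  simp only [Prod.mk.injEq] at he₁ he₂
  have hm : m < F.length := by
    by_contra hm
    rw [List.getD_eq_default _ _ (not_lt.1 hm)] at hl₁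
    simp at hl₁
  have hx : l₁.1 = l₂.1 := by
    have := (List.idxOf_inj (l := sortedVars F) (x := l₁.1) (y := l₂.1)
      (mem_sortedVars.2 (fst_mem_vars_of_mem hl₁))).1 (he₁.1.trans he₂.1.symm)
    exact this
  rw [List.getD_eq_getElem _ _ hm] at hl₁ hl₂
  have hC : (F[m]).toFinset ∈ F.clauseFinsets := List.mem_map.2 ⟨F[m], List.getElem_mem hm, rfl⟩
  refine hF _ hC l₁.1 ⟨?_, ?_⟩
  · have : l₁ = (l₁.1, true) := Prod.ext rfl he₁.2
    rw [← this]; exact List.mem_toFinset.2 hl₁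
  · have : l₂ = (l₁.1, false) := Prod.ext hx.symm he₂.2
    rw [← this]; exact List.mem_toFinset.2 hl₂

/-- **Unsatisfiability of `F` in the form used by the adversary**: every full clause over the
variable indices (`x_ℓ^{c ℓ}` for `ℓ < n`) is a weakening of some re-indexed clause `C_m` of `F`
(apply unsatisfiability to the assignment falsifying the full clause).
[cite: Garlik2019, proof of Lemma 17 (case 1: "since F is unsatisfiable, it must contain a clause
C_m of which C_{i,j} is a weakening")] -/
theorem exists_fclause_subset_of_not_satisfiable {F : CNF ℕ} (hF : ¬ F.Satisfiable)
    (c : ℕ → Bool) :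
    ∃ m < F.length, fclause (sortedVars F) F m ⊆
      (Finset.range (CNF.vars F).card).image fun ℓ => (ℓ, c ℓ) := by
  classical
  set σ : ℕ → Bool := fun x => !c ((sortedVars F).idxOf x) with hσ
  have hev : ¬ (∀ d ∈ F, Clause.eval σ d = true) := fun h =>
    hF ⟨σ, (CNF.eval_eq_true_iff F σ).2 h⟩
  push Not at hev
  obtain ⟨d, hd, hfalse⟩ := hev
  obtain ⟨m, hm, rfl⟩ := List.mem_iff_getElem.1 hd
  refine ⟨m, hm, fun q hq => ?_⟩
  obtain ⟨l, hl, rfl⟩ := mem_fclause.1 hq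
  have hl' : l ∈ F[m] := by rwa [List.getD_eq_getElem _ _ hm] at hl
  have hlit : Literal.eval σ l = false := by
    have h2 : Clause.eval σ F[m] = false := by
      cases h : Clause.eval σ F[m]
      · rfl
      · exact absurd h hfalse
    simp only [Clause.eval, List.any_eq_false] at h2
    simpa using h2 l hl'
  simp only [Literal.eval, hσ] at hlit
  simp only [Finset.mem_image, Finset.mem_range, Prod.mk.injEq]
  refine ⟨(sortedVars F).idxOf l.1, idxOf_lt_of_mem hl, rfl, ?_⟩
  revert hlit
  cases l.2 <;> cases c ((sortedVars F).idxOf l.1) <;> simp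

end LevelledRefCNF

end Literature.Computability.MetaComplexity
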